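import Summits.Ventures.GridStability.Bench.NE39KsRoaModel
import Summits.Ventures.GridStability.Bench.NE39KsRoaBall
import Mathlib.Analysis.SpecialFunctions.Trigonometric.Bounds
import HarnessLib

/-!
# «#73-roa» region-size rider in MACHINE coordinates: a Euclidean ball of relative rotor-angle and relative-speed deviations
# lies in the certified set of #76-cand «G1.c-NE39-roa-K» (NE39 10-machine classical model M′, λ = 1/10 synthetic)

Cell `gridfusion` (LADDER-GRIDFUSION rung G2.b / K-STREAM G2), seat gridfusion-lyap-2 (g2); rider material for #76-cand (lead
RULING 5n). Composition of `NE39KsRoaBall.V_le_of_ball` (kernel: `Σₖ zₖ² ≤ 127/T ⇒ V ≤ 127` on `{h = 0}`, `T = 243370863/1024`,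
ONE 27×27 integer Gram certificate) with `NE39KsRoaModel.model_roa_wellPosed` (the ∃! sentence) through the elementary bound
`sin² u + (1 − cos u)² = 2(1 − cos u) ≤ u²` (Mathlib `Real.one_sub_sq_div_two_le_cos`): the recast state `Z x` of a machine state
`x` has `Σₖ (Z x)ₖ² ≤ Σᵢ uᵢ(x)² + Σᵢ (ωᵢ − ω₀)²`.

STATEMENT (`model_roa_ball`): for every common acceleration `a′` and every machine state `x₀` of M′ whose nine relative
rotor-angle deviations `uᵢ = (δᵢ − δ₀) − (θ*ᵢ − θ*₀)` and nine relative speed deviations `ωᵢ − ω₀` (i = 1 … 9; index 0 =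
generator 2) satisfy `Σᵢ uᵢ² + Σᵢ (ωᵢ − ω₀)² ≤ 127/T` (radius `√(127/T) ≈ 0.02312`; e.g. ONE relative angle displaced by ≤ 1.32°
with everything else at equilibrium, or all eighteen deviations ≤ 0.00544): there is EXACTLY ONE solution of
`NE39.preLossless.toModelRel (1/10) a′` on `ℝ` through `x₀`, and it keeps `V(Z(c t)) ≤ 127` for all `t ≥ 0`, never pole-slips
(`|uᵢ(t)| < π`), and has `uᵢ(t) → 0`, `ωᵢ(t) − ω₀(t) → 0` (i = 1 … 9).

THREE COLUMNS (LADDER-GRIDFUSION). CERTIFIED (kernel, axioms standard): the statement above for MODEL M′. MODELLED: M′ =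
model-1's `NE39.preLossless.toModelRel (1/10) a′` — New England 10-machine 39-bus CLASSICAL model (Padiyar 2013 App. D data as
typed in `Models/NE39.lean`), PRE-fault network made LOSSLESS, h12 couplings with `E := 1` (E6), printed inertias, DECLARED
SYNTHETIC uniform damping `D_i = M_i/10` (printed `D = 0`), `P_i = e_i + M_i a′` — MODEL-VALIDITY tokens «MV-2 + MV-P(k = 8) +
MV-λ(1/10) + MV-h12 + MV-E6» (model-2), custody Row KS (model-4); a census / pipeline object, NOT a sentence about the printed
(undamped) system nor about any fault. VALIDATED (size context only, float probe of the kernel `V` by lyap-2, never the claim):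
single-machine angular half-widths of `{V ≤ 127} ∩ {h = 0}` are 1.4°–3.4°, relative-speed half-widths 0.28–0.42 rad/s — the
certified sublevel set is a SMALL neighbourhood of the synchronous equilibrium; the kernel ball here is an inner bound of it.
No sentence of this file says a machine or a grid is stable.
-/

namespace Summit.Ventures.GridStability.Bench.NE39Ks

open Set Filter Metric Topology Real
open Summit.Ventures.GridStability.Lyapunov Summit.Ventures.GridStability.Models
open Literature.Computation.Certificates Literature.Computation.Certificates.SOS

noncomputable section

/-- `sin² u + (1 − cos u)² ≤ u²` (`= 2(1 − cos u)` and `cos u ≥ 1 − u²/2`). [folklore] -/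
theorem sin_sq_add_one_sub_cos_sq_le (u : ℝ) : sin u ^ 2 + (1 - cos u) ^ 2 ≤ u ^ 2 := by
  nlinarith [sin_sq_add_cos_sq u, Real.one_sub_sq_div_two_le_cos (x := u)]

/-- The recast state of a machine state is no farther from the origin than the machine deviations: `Σₖ (Z x)ₖ² ≤ Σᵢ uᵢ² + Σᵢ (ωᵢ − ω₀)²`. [folklore] -/
theorem sumsq_val_Z_le (x : ClassicalSwing.State 10) :
    val (Z x) 0 ^ 2 + val (Z x) 1 ^ 2 + val (Z x) 2 ^ 2 + val (Z x) 3 ^ 2 + val (Z x) 4 ^ 2 + val (Z x) 5 ^ 2 + val (Z x) 6 ^ 2 + val (Z x) 7 ^ 2 + val (Z x) 8 ^ 2 + val (Z x) 9 ^ 2 + val (Z x) 10 ^ 2 + val (Z x) 11 ^ 2 + val (Z x) 12 ^ 2 + val (Z x) 13 ^ 2 + val (Z x) 14 ^ 2 + val (Z x) 15 ^ 2 + val (Z x) 16 ^ 2 + val (Z x) 17 ^ 2 + val (Z x) 18 ^ 2 + val (Z x) 19 ^ 2 + val (Z x) 20 ^ 2 + val (Z x) 21 ^ 2 + val (Z x)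 22 ^ 2 + val (Z x) 23 ^ 2 + val (Z x) 24 ^ 2 + val (Z x) 25 ^ 2 + val (Z x) 26 ^ 2 ≤
      RecastData.u NE39.preLossless.angleOf x 1 ^ 2 + RecastData.u NE39.preLossless.angleOf x 2 ^ 2 + RecastData.u NE39.preLossless.angleOf x 3 ^ 2 + RecastData.u NE39.preLossless.angleOf x 4 ^ 2 + RecastData.u NE39.preLossless.angleOf x 5 ^ 2 + RecastData.u NE39.preLossless.angleOf x 6 ^ 2 + RecastData.u NE39.preLossless.angleOf x 7 ^ 2 + RecastData.u NE39.preLossless.angleOf x 8 ^ 2 + RecastData.u NE39.preLossless.angleOf x 9 ^ 2 +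
      ((x.2 1 - x.2 0) ^ 2 + (x.2 2 - x.2 0) ^ 2 + (x.2 3 - x.2 0) ^ 2 + (x.2 4 - x.2 0) ^ 2 + (x.2 5 - x.2 0) ^ 2 + (x.2 6 - x.2 0) ^ 2 + (x.2 7 - x.2 0) ^ 2 + (x.2 8 - x.2 0) ^ 2 + (x.2 9 - x.2 0) ^ 2) := by
  rw [val_lt _ (by norm_num : 0 < 27), val_lt _ (by norm_num : 1 < 27), val_lt _ (by norm_num : 2 < 27), val_lt _ (by norm_num : 3 < 27), val_lt _ (by norm_num : 4 < 27), val_lt _ (by norm_num : 5 < 27), val_lt _ (by norm_num : 6 < 27), val_lt _ (by norm_num : 7 < 27), val_lt _ (by norm_num : 8 < 27), val_lt _ (by norm_num : 9 < 27), val_lt _ (by norm_num : 10 < 27), val_lt _ (by norm_num : 11 < 27), val_lt _ (by norm_num : 12 < 27), val_lt _ (by norm_num : 13 < 27), val_lt _ (by norm_num : 14 < 27), val_lt _ (by norm_num : 15 < 27), val_lt _ (by norm_num : 16 < 27), val_lt _ (by norm_num : 17 < 27), val_lt _ (by norm_num : 18 < 27), val_lt _ (by norm_num : 19 < 27), val_lt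 _ (by norm_num : 20 < 27), val_lt _ (by norm_num : 21 < 27), val_lt _ (by norm_num : 22 < 27), val_lt _ (by norm_num : 23 < 27), val_lt _ (by norm_num : 24 < 27), val_lt _ (by norm_num : 25 < 27), val_lt _ (by norm_num : 26 < 27)]
  rw [Z_eq_0, Z_eq_1, Z_eq_2, Z_eq_3, Z_eq_4, Z_eq_5, Z_eq_6, Z_eq_7, Z_eq_8, Z_eq_9, Z_eq_10, Z_eq_11, Z_eq_12, Z_eq_13, Z_eq_14, Z_eq_15, Z_eq_16, Z_eq_17, Z_eq_18, Z_eq_19, Z_eq_20, Z_eq_21, Z_eq_22, Z_eq_23, Z_eq_24, Z_eq_25, Z_eq_26]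
  have b0 := sin_sq_add_one_sub_cos_sq_le (RecastData.u NE39.preLossless.angleOf x 1)
  have b1 := sin_sq_add_one_sub_cos_sq_le (RecastData.u NE39.preLossless.angleOf x 2)
  have b2 := sin_sq_add_one_sub_cos_sq_le (RecastData.u NE39.preLossless.angleOf x 3)
  have b3 := sin_sq_add_one_sub_cos_sq_le (RecastData.u NE39.preLossless.angleOf x 4)
  have b4 := sin_sq_add_one_sub_cos_sq_le (RecastData.u NE39.preLossless.angleOf x 5)
  have b5 := sin_sq_add_one_sub_cos_sq_le (RecastData.u NE39.preLossless.angleOf x 6)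
  have b6 := sin_sq_add_one_sub_cos_sq_le (RecastData.u NE39.preLossless.angleOf x 7)
  have b7 := sin_sq_add_one_sub_cos_sq_le (RecastData.u NE39.preLossless.angleOf x 8)
  have b8 := sin_sq_add_one_sub_cos_sq_le (RecastData.u NE39.preLossless.angleOf x 9)
  linarith

/-- **«#73-roa» region-size rider, machine coordinates (∃! form).** See the module docstring (three columns). For every `a′`
and every machine state `x₀` with `Σᵢ uᵢ(x₀)² + Σᵢ (ωᵢ − ω₀)² ≤ 127/T` (`T = NE39Ks.ballT = 243370863/1024`): exactly one solution
of M′ on `ℝ` through `x₀`; it keeps `V(Z(c t)) ≤ 127` (`t ≥ 0`), never pole-slips, `uᵢ(t) → 0`, `ωᵢ(t) − ω₀(t) → 0`. [folklore] -/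
theorem model_roa_ball (a : ℝ) {x₀ : ClassicalSwing.State 10}
    (hball : RecastData.u NE39.preLossless.angleOf x₀ 1 ^ 2 + RecastData.u NE39.preLossless.angleOf x₀ 2 ^ 2 + RecastData.u NE39.preLossless.angleOf x₀ 3 ^ 2 + RecastData.u NE39.preLossless.angleOf x₀ 4 ^ 2 + RecastData.u NE39.preLossless.angleOf x₀ 5 ^ 2 + RecastData.u NE39.preLossless.angleOf x₀ 6 ^ 2 + RecastData.u NE39.preLossless.angleOf x₀ 7 ^ 2 + RecastData.u NE39.preLossless.angleOf x₀ 8 ^ 2 + RecastData.u NE39.preLossless.angleOf x₀ 9 ^ 2 +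
        ((x₀.2 1 - x₀.2 0) ^ 2 + (x₀.2 2 - x₀.2 0) ^ 2 + (x₀.2 3 - x₀.2 0) ^ 2 + (x₀.2 4 - x₀.2 0) ^ 2 + (x₀.2 5 - x₀.2 0) ^ 2 + (x₀.2 6 - x₀.2 0) ^ 2 + (x₀.2 7 - x₀.2 0) ^ 2 + (x₀.2 8 - x₀.2 0) ^ 2 + (x₀.2 9 - x₀.2 0) ^ 2) ≤ 127 / (ballT : ℝ)) :
    (∃! c : ℝ → ClassicalSwing.State 10, c 0 = x₀ ∧ (NE39.preLossless.toModelRel (1 / 10) a).IsSolutionOn c univ) ∧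
    ∀ c : ℝ → ClassicalSwing.State 10, c 0 = x₀ → (NE39.preLossless.toModelRel (1 / 10) a).IsSolutionOn c univ →
      (∀ t, 0 ≤ t → Vz (Z (c t)) ≤ 127) ∧
      (∀ i : Fin 9, ∀ t, 0 ≤ t → |RecastData.u NE39.preLossless.angleOf (c t) i.succ| < π) ∧
      (∀ i : Fin 9, Tendsto (fun t => RecastData.u NE39.preLossless.angleOf (c t) i.succ) atTop (𝓝 0)) ∧
      (∀ i : Fin 9, Tendsto (fun t => (c t).2 i.succ - (c t).2 0) atTop (𝓝 0)) := by
  have hT : (127 : ℝ) / (ballT : ℝ) ≤ 1 := by unfold ballT; norm_num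
  have hZ := sumsq_val_Z_le x₀
  have hV : Vz (Z x₀) ≤ 127 := V_le_of_ball (val (Z x₀)) (Z_mem_M x₀) (hZ.trans hball)
  have hwin : ∀ i : Fin 9, |RecastData.u NE39.preLossless.angleOf x₀ i.succ| < π := by
    intro i
    have hpi := Real.pi_gt_three
    have hsq : RecastData.u NE39.preLossless.angleOf x₀ i.succ ^ 2 ≤ 1 := by
      fin_cases i
      · show RecastData.u NE39.preLossless.angleOf x₀ 1 ^ 2 ≤ 1
        linarith [sq_nonneg (RecastData.u NE39.preLossless.angleOf x₀ 1), sq_nonneg (RecastData.u NE39.preLossless.angleOf x₀ 2), sq_nonneg (RecastData.u NE39.preLossless.angleOf x₀ 3), sq_nonneg (RecastData.u NE39.preLossless.angleOf x₀ 4), sq_nonneg (RecastData.u NE39.preLossless.angleOf x₀ 5), sq_nonneg (RecastData.u NE39.preLossless.angleOf x₀ 6), sq_nonneg (RecastData.u NE39.preLossless.angleOf x₀ 7), sq_nonneg (RecastData.u NE39.preLossless.angleOf x₀ 8), sq_nonneg (RecastData.u NE39.preLossless.angleOf x₀ 9), sq_nonneg (x₀.2 1 - x₀.2 0), sq_nonneg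 (x₀.2 2 - x₀.2 0), sq_nonneg (x₀.2 3 - x₀.2 0), sq_nonneg (x₀.2 4 - x₀.2 0), sq_nonneg (x₀.2 5 - x₀.2 0), sq_nonneg (x₀.2 6 - x₀.2 0), sq_nonneg (x₀.2 7 - x₀.2 0), sq_nonneg (x₀.2 8 - x₀.2 0), sq_nonneg (x₀.2 9 - x₀.2 0)]
      · show RecastData.u NE39.preLossless.angleOf x₀ 2 ^ 2 ≤ 1
        linarith [sq_nonneg (RecastData.u NE39.preLossless.angleOf x₀ 1), sq_nonneg (RecastData.u NE39.preLossless.angleOf x₀ 2), sq_nonneg (RecastData.u NE39.preLossless.angleOf x₀ 3), sq_nonneg (RecastData.u NE39.preLossless.angleOf x₀ 4), sq_nonneg (RecastData.u NE39.preLossless.angleOf x₀ 5), sq_nonneg (RecastData.u NE39.preLossless.angleOf x₀ 6), sq_nonneg (RecastData.u NE39.preLossless.angleOf x₀ 7), sq_nonneg (RecastData.u NE39.preLossless.angleOf x₀ 8), sq_nonneg (RecastData.u NE39.preLossless.angleOf x₀ 9), sq_nonneg (x₀.2 1 - x₀.2 0), sq_nonneg (x₀.2 2 - x₀.2 0), sq_nonneg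 (x₀.2 3 - x₀.2 0), sq_nonneg (x₀.2 4 - x₀.2 0), sq_nonneg (x₀.2 5 - x₀.2 0), sq_nonneg (x₀.2 6 - x₀.2 0), sq_nonneg (x₀.2 7 - x₀.2 0), sq_nonneg (x₀.2 8 - x₀.2 0), sq_nonneg (x₀.2 9 - x₀.2 0)]
      · show RecastData.u NE39.preLossless.angleOf x₀ 3 ^ 2 ≤ 1
        linarith [sq_nonneg (RecastData.u NE39.preLossless.angleOf x₀ 1), sq_nonneg (RecastData.u NE39.preLossless.angleOf x₀ 2), sq_nonneg (RecastData.u NE39.preLossless.angleOf x₀ 3), sq_nonneg (RecastData.u NE39.preLossless.angleOf x₀ 4), sq_nonneg (RecastData.u NE39.preLossless.angleOf x₀ 5), sq_nonneg (RecastData.u NE39.preLossless.angleOf x₀ 6), sq_nonneg (RecastData.u NE39.preLossless.angleOf x₀ 7), sq_nonneg (RecastData.u NE39.preLossless.angleOf x₀ 8), sq_nonneg (RecastData.u NE39.preLossless.angleOf x₀ 9), sq_nonneg (x₀.2 1 - x₀.2 0), sq_nonneg (x₀.2 2 - x₀.2 0), sq_nonneg (x₀.2 3 - x₀.2 0), sq_nonneg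 (x₀.2 4 - x₀.2 0), sq_nonneg (x₀.2 5 - x₀.2 0), sq_nonneg (x₀.2 6 - x₀.2 0), sq_nonneg (x₀.2 7 - x₀.2 0), sq_nonneg (x₀.2 8 - x₀.2 0), sq_nonneg (x₀.2 9 - x₀.2 0)]
      · show RecastData.u NE39.preLossless.angleOf x₀ 4 ^ 2 ≤ 1
        linarith [sq_nonneg (RecastData.u NE39.preLossless.angleOf x₀ 1), sq_nonneg (RecastData.u NE39.preLossless.angleOf x₀ 2), sq_nonneg (RecastData.u NE39.preLossless.angleOf x₀ 3), sq_nonneg (RecastData.u NE39.preLossless.angleOf x₀ 4), sq_nonneg (RecastData.u NE39.preLossless.angleOf x₀ 5), sq_nonneg (RecastData.u NE39.preLossless.angleOf x₀ 6), sq_nonneg (RecastData.u NE39.preLossless.angleOf x₀ 7), sq_nonneg (RecastData.u NE39.preLossless.angleOf x₀ 8), sq_nonneg (RecastData.u NE39.preLossless.angleOf x₀ 9), sq_nonneg (x₀.2 1 - x₀.2 0), sq_nonneg (x₀.2 2 - x₀.2 0), sq_nonneg (x₀.2 3 - x₀.2 0), sq_nonneg (x₀.2 4 - x₀.2 0), sq_nonneg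 (x₀.2 5 - x₀.2 0), sq_nonneg (x₀.2 6 - x₀.2 0), sq_nonneg (x₀.2 7 - x₀.2 0), sq_nonneg (x₀.2 8 - x₀.2 0), sq_nonneg (x₀.2 9 - x₀.2 0)]
      · show RecastData.u NE39.preLossless.angleOf x₀ 5 ^ 2 ≤ 1
        linarith [sq_nonneg (RecastData.u NE39.preLossless.angleOf x₀ 1), sq_nonneg (RecastData.u NE39.preLossless.angleOf x₀ 2), sq_nonneg (RecastData.u NE39.preLossless.angleOf x₀ 3), sq_nonneg (RecastData.u NE39.preLossless.angleOf x₀ 4), sq_nonneg (RecastData.u NE39.preLossless.angleOf x₀ 5), sq_nonneg (RecastData.u NE39.preLossless.angleOf x₀ 6), sq_nonneg (RecastData.u NE39.preLossless.angleOf x₀ 7), sq_nonneg (RecastData.u NE39.preLossless.angleOf x₀ 8), sq_nonneg (RecastData.u NE39.preLossless.angleOf x₀ 9), sq_nonneg (x₀.2 1 - x₀.2 0), sq_nonneg (x₀.2 2 - x₀.2 0), sq_nonneg (x₀.2 3 - x₀.2 0), sq_nonneg (x₀.2 4 - x₀.2 0), sq_nonneg (x₀.2 5 - x₀.2 0), sq_nonneg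 (x₀.2 6 - x₀.2 0), sq_nonneg (x₀.2 7 - x₀.2 0), sq_nonneg (x₀.2 8 - x₀.2 0), sq_nonneg (x₀.2 9 - x₀.2 0)]
      · show RecastData.u NE39.preLossless.angleOf x₀ 6 ^ 2 ≤ 1
        linarith [sq_nonneg (RecastData.u NE39.preLossless.angleOf x₀ 1), sq_nonneg (RecastData.u NE39.preLossless.angleOf x₀ 2), sq_nonneg (RecastData.u NE39.preLossless.angleOf x₀ 3), sq_nonneg (RecastData.u NE39.preLossless.angleOf x₀ 4), sq_nonneg (RecastData.u NE39.preLossless.angleOf x₀ 5), sq_nonneg (RecastData.u NE39.preLossless.angleOf x₀ 6), sq_nonneg (RecastData.u NE39.preLossless.angleOf x₀ 7), sq_nonneg (RecastData.u NE39.preLossless.angleOf x₀ 8), sq_nonneg (RecastData.u NE39.preLossless.angleOf x₀ 9), sq_nonneg (x₀.2 1 - x₀.2 0), sq_nonneg (x₀.2 2 - x₀.2 0), sq_nonneg (x₀.2 3 - x₀.2 0), sq_nonneg (x₀.2 4 - x₀.2 0), sq_nonneg (x₀.2 5 - x₀.2 0), sq_nonneg (x₀.2 6 - x₀.2 0), sq_nonneg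 (x₀.2 7 - x₀.2 0), sq_nonneg (x₀.2 8 - x₀.2 0), sq_nonneg (x₀.2 9 - x₀.2 0)]
      · show RecastData.u NE39.preLossless.angleOf x₀ 7 ^ 2 ≤ 1
        linarith [sq_nonneg (RecastData.u NE39.preLossless.angleOf x₀ 1), sq_nonneg (RecastData.u NE39.preLossless.angleOf x₀ 2), sq_nonneg (RecastData.u NE39.preLossless.angleOf x₀ 3), sq_nonneg (RecastData.u NE39.preLossless.angleOf x₀ 4), sq_nonneg (RecastData.u NE39.preLossless.angleOf x₀ 5), sq_nonneg (RecastData.u NE39.preLossless.angleOf x₀ 6), sq_nonneg (RecastData.u NE39.preLossless.angleOf x₀ 7), sq_nonneg (RecastData.u NE39.preLossless.angleOf x₀ 8), sq_nonneg (RecastData.u NE39.preLossless.angleOf x₀ 9), sq_nonneg (x₀.2 1 - x₀.2 0), sq_nonneg (x₀.2 2 - x₀.2 0), sq_nonneg (x₀.2 3 - x₀.2 0), sq_nonneg (x₀.2 4 - x₀.2 0), sq_nonneg (x₀.2 5 - x₀.2 0), sq_nonneg (x₀.2 6 - x₀.2 0), sq_nonneg (x₀.2 7 - x₀.2 0), sq_nonneg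 (x₀.2 8 - x₀.2 0), sq_nonneg (x₀.2 9 - x₀.2 0)]
      · show RecastData.u NE39.preLossless.angleOf x₀ 8 ^ 2 ≤ 1
        linarith [sq_nonneg (RecastData.u NE39.preLossless.angleOf x₀ 1), sq_nonneg (RecastData.u NE39.preLossless.angleOf x₀ 2), sq_nonneg (RecastData.u NE39.preLossless.angleOf x₀ 3), sq_nonneg (RecastData.u NE39.preLossless.angleOf x₀ 4), sq_nonneg (RecastData.u NE39.preLossless.angleOf x₀ 5), sq_nonneg (RecastData.u NE39.preLossless.angleOf x₀ 6), sq_nonneg (RecastData.u NE39.preLossless.angleOf x₀ 7), sq_nonneg (RecastData.u NE39.preLossless.angleOf x₀ 8), sq_nonneg (RecastData.u NE39.preLossless.angleOf x₀ 9), sq_nonneg (x₀.2 1 - x₀.2 0), sq_nonneg (x₀.2 2 - x₀.2 0), sq_nonneg (x₀.2 3 - x₀.2 0), sq_nonneg (x₀.2 4 - x₀.2 0), sq_nonneg (x₀.2 5 - x₀.2 0), sq_nonneg (x₀.2 6 - x₀.2 0), sq_nonneg (x₀.2 7 - x₀.2 0), sq_nonneg (x₀.2 8 - x₀.2 0), sq_nonneg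 (x₀.2 9 - x₀.2 0)]
      · show RecastData.u NE39.preLossless.angleOf x₀ 9 ^ 2 ≤ 1
        linarith [sq_nonneg (RecastData.u NE39.preLossless.angleOf x₀ 1), sq_nonneg (RecastData.u NE39.preLossless.angleOf x₀ 2), sq_nonneg (RecastData.u NE39.preLossless.angleOf x₀ 3), sq_nonneg (RecastData.u NE39.preLossless.angleOf x₀ 4), sq_nonneg (RecastData.u NE39.preLossless.angleOf x₀ 5), sq_nonneg (RecastData.u NE39.preLossless.angleOf x₀ 6), sq_nonneg (RecastData.u NE39.preLossless.angleOf x₀ 7), sq_nonneg (RecastData.u NE39.preLossless.angleOf x₀ 8), sq_nonneg (RecastData.u NE39.preLossless.angleOf x₀ 9), sq_nonneg (x₀.2 1 - x₀.2 0), sq_nonneg (x₀.2 2 - x₀.2 0), sq_nonneg (x₀.2 3 - x₀.2 0), sq_nonneg (x₀.2 4 - x₀.2 0), sq_nonneg (x₀.2 5 - x₀.2 0), sq_nonneg (x₀.2 6 - x₀.2 0), sq_nonneg (x₀.2 7 - x₀.2 0), sq_nonneg (x₀.2 8 - x₀.2 0), sq_nonneg (x₀.2 9 - x₀.2 0)]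
    have h1 := (sq_le_one_iff_abs_le_one _).1 hsq
    linarith
  exact model_roa_wellPosed a (γ := 127) (by norm_num) le_rfl hV hwin

end

end Summit.Ventures.GridStability.Bench.NE39Ks
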